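import Summits.BirchSwinnertonDyer.BirchSwinnertonDyer.Theorems.ManinLocalTwoThreeShimuraKernelHeckeU
import Summits.BirchSwinnertonDyer.BirchSwinnertonDyer.Theorems.ManinLocalTwoThreeShimuraKernelAtkinLehnerSigns
import Literature.NumberTheory.EllipticCurves.AtkinLehnerInvolutionsProofs
import HarnessLib

/-!
# Atkin–Lehner signs at the MULTIPLICATIVE primes of a Shimura `3`-kernel (unconditional): `q ∥ N`, `q ≡ 1 (3)` ⟹ `w_q = −1`; `q ≡ 2 (3)` ⟹ `w_q = +1`; hence at most ONE prime `≡ 1 (mod 3)` divides `N` exactly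
(route `ManinLocalTwoThree`, crux C3 stmt-BirchSwinnertonDyer-22968; cell bsd-f2-manin, C3 LEAD p1 gen 17; `--supports stmt-BirchSwinnertonDyer-22968`; node E-an-221 —
eighth habitat file: the U_q congruence `3 ∣ a_q − q` (p742991) meets `w_q f = −a_q f` for `q ∥ N` (tree theorem `IsNewform0.atkinLehnerInvolution_eq_smul_of_not_dvd`,
Knapp Thm. 9.27) and the sign pattern «no two minus divisors» (p742140))

HONEST FRAMING.  Unconditional; E-an-221 on its habitat, RES₃♭, C3, Manin's conjecture and BSD are NOT proved.  No definitions, no named facts, no sorry.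
[cite: Knapp1993, Thm. 9.27] [cite: AtkinLehner1970, Thm. 3] [cite: LingOesterle1991, Thm. 6 (shape)]
-/

set_option autoImplicit false
-- lint-debt: the directory name repeats the summit name (sibling precedent `ManinLocalTwoThreeShimuraKernelHeckeU.lean`)
set_option linter.dupNamespace false

noncomputable section

open scoped Classical MatrixGroups ModularForm PeriodPair
open CongruenceSubgroup Complex
open WeierstrassCurve Literature.NumberTheory.EllipticCurves Literature.NumberTheory.EllipticCurves.ModularForms
open Summit.BirchSwinnertonDyer.Rank1Residual.ManinAdditive.UDCKummerLine
open Summit.BirchSwinnertonDyer.Rank1Residual.ManinAdditive.UDCKummerLineK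
open Summit.BirchSwinnertonDyer.Rank1Residual.ManinAdditive.ShimuraThreeTorsion

namespace Summit.BirchSwinnertonDyer.BirchSwinnertonDyer.Theorems.ManinLocalTwoThree.SigmaHabitat

variable {W : WeierstrassCurve ℚ} {N : ℕ} [NeZero N]

/-- `w_q f = −a_q(W)·f` for the newform of an `X₀(N)`-datum at `q ∥ N` (weight 2: `q^{1−k/2} = 1`). [cite: Knapp1993, Thm. 9.27] -/
theorem atkinLehner_eq_neg_lFunction_smul (D : ModularParametrizationData W N) {q : ℕ} [Fact q.Prime] {M : ℕ}
    (hN : N = q * M) (hqM : ¬ q ∣ M) :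
    haveI : NeZero q := ⟨(Fact.out : q.Prime).ne_zero⟩
    atkinLehnerInvolution N 2 q D.f = (-((W.LFunction q : ℤ) : ℂ)) • D.f := by
  haveI : NeZero q := ⟨(Fact.out : q.Prime).ne_zero⟩
  have h := D.isNewformOf.1.atkinLehnerInvolution_eq_smul_of_not_dvd q hN hqM
  have hc : (UpperHalfPlane.qExpansion 1 ⇑D.f).coeff q = ((W.LFunction q : ℤ) : ℂ) := D.isNewformOf.2 q
  have hpow : (((q : ℝ) ^ (1 - ((2 : ℤ) : ℝ) / 2) : ℝ) : ℂ) = 1 := by norm_num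
  rw [hc, hpow] at h
  simpa using h

/-- **`q ∥ N`, KummerShimura, `9 ∣ N` ⟹ `w_q f = (−1)^{[q ≡ 1 (3)]}·f`**: `a_q ∈ {±1}` (`w_q = −a_q`, `w_q² = 1`) and `3 ∣ a_q − q`.  Case `q ≡ 1 (mod 3)`: `w_q f = −f`.
[cite: Knapp1993, Thm. 9.27] [cite: LingOesterle1991, Thm. 6 (shape)] -/
theorem atkinLehner_minus_of_kummerShimura_of_mod_three_eq_one (D : ModularParametrizationData W N)
    (hopt : ∀ z ∈ D.L.lattice, ∃ w ∈ periodLattice D.f, z = D.c * w) (h9 : 3 ^ 2 ∣ N)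
    {u : ℂ} (hu₂ : 3 * u ∈ D.L.lattice) (hS : KummerShimura D u)
    {q : ℕ} [Fact q.Prime] [NeZero q] {M : ℕ} (hN : N = q * M) (hqM : ¬ q ∣ M) (hq1 : q % 3 = 1) :
    atkinLehnerInvolution N 2 q D.f = (-1 : ℂ) • D.f := by
  have hq : q.Prime := Fact.out
  have hqN : q ∣ N := ⟨M, hN⟩
  have hNq : N / q = M := by rw [hN, Nat.mul_div_cancel_left M hq.pos]
  have hc : Nat.Coprime q (N / q) := by rw [hNq]; exact hq.coprime_iff_not_dvd.mpr hqM
  have h3 := three_dvd_lFunction_sub_self_of_kummerShimura D hopt h9 hu₂ hS hqN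
  have hw := atkinLehner_eq_neg_lFunction_smul D hN hqM
  rcases atkinLehner_eq_smul_or D q hqN hc with h | h
  · exfalso
    -- `−a_q = 1`, so `a_q = −1`, but `3 ∣ a_q − q` with `q ≡ 1 (mod 3)`
    have hf0 : D.f ≠ 0 := fun h0 ↦ D.isNewformOf.1.coe_ne_zero (by rw [h0]; rfl)
    have heq : (-((W.LFunction q : ℤ) : ℂ)) = 1 := by
      rw [h] at hw
      have h2 : ((1 : ℂ) - -((W.LFunction q : ℤ) : ℂ)) • D.f = 0 := by rw [sub_smul, ← hw, sub_self]
      have := (smul_eq_zero.mp h2).resolve_right hf0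
      linear_combination -this
    have ha : (W.LFunction q : ℤ) = -1 := by exact_mod_cast (by linear_combination -heq : ((W.LFunction q : ℤ) : ℂ) = -1)
    rw [ha] at h3
    omega
  · exact h

/-- **`q ∥ N`, `q ≡ 2 (mod 3)`, KummerShimura ⟹ `w_q f = +f`** (non-split multiplicative reduction). [cite: Knapp1993, Thm. 9.27] -/
theorem atkinLehner_plus_of_kummerShimura_of_mod_three_eq_two (D : ModularParametrizationData W N)
    (hopt : ∀ z ∈ D.L.lattice, ∃ w ∈ periodLattice D.f, z = D.c * w) (h9 : 3 ^ 2 ∣ N)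
    {u : ℂ} (hu₂ : 3 * u ∈ D.L.lattice) (hS : KummerShimura D u)
    {q : ℕ} [Fact q.Prime] [NeZero q] {M : ℕ} (hN : N = q * M) (hqM : ¬ q ∣ M) (hq2 : q % 3 = 2) :
    atkinLehnerInvolution N 2 q D.f = (1 : ℂ) • D.f := by
  have hq : q.Prime := Fact.out
  have hqN : q ∣ N := ⟨M, hN⟩
  have hNq : N / q = M := by rw [hN, Nat.mul_div_cancel_left M hq.pos]
  have hc : Nat.Coprime q (N / q) := by rw [hNq]; exact hq.coprime_iff_not_dvd.mpr hqM
  have h3 := three_dvd_lFunction_sub_self_of_kummerShimura D hopt h9 hu₂ hS hqN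
  have hw := atkinLehner_eq_neg_lFunction_smul D hN hqM
  rcases atkinLehner_eq_smul_or D q hqN hc with h | h
  · exact h
  · exfalso
    have hf0 : D.f ≠ 0 := fun h0 ↦ D.isNewformOf.1.coe_ne_zero (by rw [h0]; rfl)
    have heq : (-((W.LFunction q : ℤ) : ℂ)) = -1 := by
      rw [h] at hw
      have h2 : ((-1 : ℂ) - -((W.LFunction q : ℤ) : ℂ)) • D.f = 0 := by rw [sub_smul, ← hw, sub_self]
      have := (smul_eq_zero.mp h2).resolve_right hf0
      linear_combination -this
    have ha : (W.LFunction q : ℤ) = 1 := by exact_mod_cast (by linear_combination -heq : ((W.LFunction q : ℤ) : ℂ) = 1)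
    rw [ha] at h3
    omega

/-- **AT MOST ONE prime `q ≡ 1 (mod 3)` divides `N` exactly on E-an-221's habitat** (two of them would be two Atkin–Lehner minus primes, p742140).
[cite: Knapp1993, Thm. 9.27] [cite: AtkinLehner1970, Thm. 3] -/
theorem eq_of_two_mod_three_eq_one_of_kummerShimura (D : ModularParametrizationData W N)
    (hopt : ∀ z ∈ D.L.lattice, ∃ w ∈ periodLattice D.f, z = D.c * w) (h9 : 3 ^ 2 ∣ N)
    {u : ℂ} (hu₂ : 3 * u ∈ D.L.lattice) (hS : KummerShimura D u)
    {q₁ q₂ : ℕ} [Fact q₁.Prime] [Fact q₂.Prime] [NeZero q₁] [NeZero q₂] {M₁ M₂ : ℕ}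
    (hN₁ : N = q₁ * M₁) (hqM₁ : ¬ q₁ ∣ M₁) (h₁ : q₁ % 3 = 1)
    (hN₂ : N = q₂ * M₂) (hqM₂ : ¬ q₂ ∣ M₂) (h₂ : q₂ % 3 = 1) : q₁ = q₂ := by
  by_contra hne
  have hp₁ : q₁.Prime := Fact.out
  have hp₂ : q₂.Prime := Fact.out
  have hq₁N : q₁ ∣ N := ⟨M₁, hN₁⟩
  have hq₂N : q₂ ∣ N := ⟨M₂, hN₂⟩
  have hc₁ : Nat.Coprime q₁ (N / q₁) := by rw [hN₁, Nat.mul_div_cancel_left M₁ hp₁.pos]; exact hp₁.coprime_iff_not_dvd.mpr hqM₁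
  have hc₂ : Nat.Coprime q₂ (N / q₂) := by rw [hN₂, Nat.mul_div_cancel_left M₂ hp₂.pos]; exact hp₂.coprime_iff_not_dvd.mpr hqM₂
  have hcop : Nat.Coprime q₁ q₂ := (Nat.coprime_primes hp₁ hp₂).mpr hne
  have hm₁ := atkinLehner_minus_of_kummerShimura_of_mod_three_eq_one D hopt h9 hu₂ hS hN₁ hqM₁ h₁
  have hm₂ := atkinLehner_minus_of_kummerShimura_of_mod_three_eq_one D hopt h9 hu₂ hS hN₂ hqM₂ h₂
  have hplus := not_two_atkinLehner_minus_of_kummerShimura D hopt h9 hu₂ hS q₁ q₂ hq₁N hc₁ hp₁.one_lt hq₂N hc₂ hp₂.one_lt hcop hm₁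
  rw [hplus] at hm₂
  have hf0 : D.f ≠ 0 := fun h0 ↦ D.isNewformOf.1.coe_ne_zero (by rw [h0]; rfl)
  have h2 : ((1 : ℂ) - -1) • D.f = 0 := by rw [sub_smul, hm₂, sub_self]
  have := (smul_eq_zero.mp h2).resolve_right hf0
  norm_num at this

end Summit.BirchSwinnertonDyer.BirchSwinnertonDyer.Theorems.ManinLocalTwoThree.SigmaHabitat

end
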